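import Literature.NumberTheory.GaloisCohomology.RestrictedRamificationEulerCharacteristicInflation
import Literature.NumberTheory.GaloisCohomology.RestrictedRamificationFiniteCoefficients
import Literature.NumberTheory.GaloisRepresentations.ContinuousShapiroOpenCoinducedTensor
import Literature.RepresentationTheory.FiniteGroups.ArtinReductionToCyclicPrimeToP
import Literature.GroupTheory.ProfiniteSubquotients
import HarnessLib

/-!
# Tate's Euler–Poincaré characteristic at a totally complex `K`: reduction of the finite `G_S`-modules
# killed by `p` to the CYCLIC subquotients of `G_S` of order PRIME TO `p` (Milne ADT I §5, p. 70)

Topic `NumberTheory/GaloisCohomology`; namespace `Literature.NumberTheory.GaloisCohomology`.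
THEOREMS ONLY (no definition, no named fact, no `sorry`, no instance; D-0026).  Lane «TATE-EPC-TC»
of cell `bsd-eis` (road memo evidence #54 on stmt-BirchSwinnertonDyer-19032), brick B9 (assembly),
cohomological half, part 1.

Milne, *Arithmetic Duality Theorems* (2006), proof of I Thm. 5.1 (p. 70): "`φ` defines a
homomorphism `R_{𝔽_p}(Ḡ) → ℚ_{>0}` … an argument as in the proof of Theorem 2.8 (using 2.10)
allows us to … assume that `Ḡ` is a cyclic group of order prime to `p`."  Here `K` is totally
complex, `S ⊇ S_p` is finite, `W ⊴ G_S = G_{K,S}` is an OPEN normal subgroup, `Q = G_S ⧸ W` (finite),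
and for a finite `ℤ[Q]`-module `Y` (any `Module ℤ` structure, re-based by
`Representation.ofIntModule`, carrier given the discrete topology)

  `ψ_W(Y) := χ_{p,e}(inflate π_W Y) = v_p #H⁰(G_S, Y) − v_p #H¹(G_S, Y) + v_p #H²(G_S, Y) + e·v_p #Y`

(`π_W : Γ_K ↠ G_S ↠ Q`; `restrictedCohomology` currency).  By -w3 g15's
`eulerChar_inflate_add` this is an additive invariant of finite `p`-torsion `ℤ[Q]`-modules
(granted the finiteness `finite_restrictedCohomology K`, Harari Cor. 17.17, a theorem at totally
complex `K` once brick B1c lands), so the finite-group half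
`ArtinReduction.additive_eq_zero_of_cyclic_primeToP` reduces `ψ_W ≡ 0` to the vanishing of
`ψ_W (M ⊗ ℤ[Q/C]/p)` for the CYCLIC `C ≤ Q` of order PRIME TO `p` — which by Shapiro's lemma in
-w7 g9's tensor dictionary (`ContinuousShapiroOpenCoinducedTensor`) reads, with
`U = C.comap (G_S → Q)`,

  `v_p #H⁰(U, M) − v_p #H¹(U, M) + v_p #H²(U, M) + [G_S : U]·e·v_p #M = 0`     (BASE)

— the statement brick B8 of the lane proves (with `e = r₂(K)`, for `W` fixing `μ_p`).

* §1 `natCard_restrictedCohomology_inflate_quotient` — `#Hⁿ(G_S, inflate π_W Y) = #Hⁿ(G_S, Y)`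
  (the `N_S`-invariants currency vs the `G_S`-module currency);
* §2 `natCard_restrictedCohomology_inflate_tprod_permQuot` — `#Hⁿ(G_S, M ⊗ ℤ[Q/C]/p) = #Hⁿ(U, M)`
  and `eulerChar_inflate_tprod_permQuot` — `ψ_W (M ⊗ ℤ[Q/C]/p) =` the left side of (BASE);
* §3 **`eulerChar_inflate_eq_zero_of_base`** — (BASE) for the cyclic `C ≤ Q` of order prime to
  `p` ⟹ `ψ_W(σ) = 0` for every finite `ℤ[Q]`-module `σ` killed by `p`.

## References
* J. S. Milne, *Arithmetic Duality Theorems*, 2nd ed. (2006), I §5 Thm. 5.1 (proof, pp. 69–70),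
  Lemma 2.10 (p. 32). [MilneADT2006]
* J.-P. Serre, *Cohomologie galoisienne* (1994) / *Galois Cohomology* (1997), I §2.5 Prop. 10
  (Shapiro). [SerreGaloisCohomology1997]
* D. Harari, *Galois Cohomology and Class Field Theory* (2020), Cor. 17.17, Def. 15.36. [Harari2020]
-/

noncomputable section

open CategoryTheory Function NumberField Field IsDedekindDomain
open scoped NumberField TensorProduct Pointwise

namespace Literature.NumberTheory.GaloisCohomology

open Literature.NumberTheory.GaloisRepresentations
open Literature.NumberTheory.GaloisRepresentations.DiscreteGaloisModule (restrictedCohomology inflate)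
open Literature.RepresentationTheory.FiniteGroups
open _root_.TopRep _root_.ContRepresentation _root_.ContinuousCohomology

variable {K : Type} [Field K] [NumberField K] (S : Set (HeightOneSpectrum (𝓞 K)))
variable (W : Subgroup (GaloisGroupUnramifiedOutside K S)) [W.Normal]

/-! ### §1. `Hⁿ(G_S, inflate π_W Y)` versus `Hⁿ(G_S, Y)` for a `Q = G_S ⧸ W`-module `Y` -/

section Inflate

variable [DiscreteTopology (GaloisGroupUnramifiedOutside K S ⧸ W)]
variable {Y : Type} [AddCommGroup Y] [TopologicalSpace Y] [DiscreteTopology Y]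

omit [NumberField K] in
/-- The `Γ_K`-inflation of a `Q`-module along `π_W : Γ_K ↠ G_S ↠ Q` is the `Γ_K`-inflation of its
`G_S`-inflation. [cite: Harari2020, Def. 15.36] -/
theorem inflate_quotient_eq (τ : Representation ℤ (GaloisGroupUnramifiedOutside K S ⧸ W) Y) :
    inflate ((ContinuousMonoidHom.quotientMk W).comp (toUnramifiedQuotCont K S)) τ =
      ((((ContinuousRep.ofDiscrete τ).restrict (ContinuousMonoidHom.quotientMk W)).restrictScalars ℤ).restrict
        (toUnramifiedQuotCont K S)) :=
  ContinuousRep.ext fun _ => rfl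

omit [NumberField K] in
/-- **`#Hⁿ(G_S, (inflate π_W Y)^{N_S}) = #Hⁿ(G_S, Y)`** (`restrictedCohomology` currency vs the
continuous cohomology of the `G_S`-inflation). [cite: Harari2020, §17.2 (p. 290) and Def. 15.36] -/
theorem natCard_restrictedCohomology_inflate_quotient
    (τ : Representation ℤ (GaloisGroupUnramifiedOutside K S ⧸ W) Y) (n : ℕ) :
    Nat.card (restrictedCohomology
        (inflate ((ContinuousMonoidHom.quotientMk W).comp (toUnramifiedQuotCont K S)) τ) S n) =
      Nat.card (continuousCohomology n
        ((ContinuousRep.ofDiscrete τ).restrict (ContinuousMonoidHom.quotientMk W)).toTopRep) := by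
  rw [inflate_quotient_eq]
  obtain ⟨e⟩ := nonempty_restrictedCohomology_addEquiv_H S
    ((ContinuousRep.ofDiscrete τ).restrict (ContinuousMonoidHom.quotientMk W)) n
  exact Nat.card_congr e.toEquiv

end Inflate

/-! ### §2. The induced module `M ⊗ ℤ[Q/C]/p`: Shapiro -/

section Tensor

variable [DiscreteTopology (GaloisGroupUnramifiedOutside K S ⧸ W)]
  (hWo : IsOpen (W : Set (GaloisGroupUnramifiedOutside K S)))
variable {M : Type} [AddCommGroup M] [TopologicalSpace M] [DiscreteTopology M]
  (σ : Representation ℤ (GaloisGroupUnramifiedOutside K S ⧸ W) M) (p : ℕ) (hM : ∀ m : M, (p : ℤ) • m = 0)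
  (C : Subgroup (GaloisGroupUnramifiedOutside K S ⧸ W)) [Fintype ((GaloisGroupUnramifiedOutside K S ⧸ W) ⧸ C)]
  [TopologicalSpace (M ⊗[ℤ] (MonoidAlgebra ℤ ((GaloisGroupUnramifiedOutside K S ⧸ W) ⧸ C) ⧸
    ((p : ℤ) • ⊤ : Submodule ℤ (MonoidAlgebra ℤ ((GaloisGroupUnramifiedOutside K S ⧸ W) ⧸ C)))))]
  [DiscreteTopology (M ⊗[ℤ] (MonoidAlgebra ℤ ((GaloisGroupUnramifiedOutside K S ⧸ W) ⧸ C) ⧸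
    ((p : ℤ) • ⊤ : Submodule ℤ (MonoidAlgebra ℤ ((GaloisGroupUnramifiedOutside K S ⧸ W) ⧸ C)))))]

include hWo hM in
/-- **Shapiro: `#Hⁿ(G_S, M ⊗ ℤ[Q/C]/p) = #Hⁿ(U, M)`**, `U = C.comap (G_S ↠ Q)`, for a `ℤ[Q]`-module `M`
killed by `p` (the tensor carrier with its canonical `ℤ`-module structure re-based by
`Representation.ofIntModule`, and any discrete topology; `G_S`-inflations throughout).
[cite: SerreGaloisCohomology1997, I §2.5 Prop. 10] [cite: MilneADT2006, I §5 (proof of Thm. 5.1, p. 70)] -/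
theorem natCard_restrictedCohomology_inflate_tprod_permQuot (n : ℕ) :
    Nat.card (restrictedCohomology
        (inflate ((ContinuousMonoidHom.quotientMk W).comp (toUnramifiedQuotCont K S))
          (Representation.ofIntModule _
            (σ.tprod (Representation.permQuot ((GaloisGroupUnramifiedOutside K S ⧸ W) ⧸ C) p))))
        S n) =
      Nat.card (continuousCohomology n
        (((ContinuousRep.ofDiscrete σ).restrict (ContinuousMonoidHom.quotientMk W)).restrict
          (subgroupIncl (C.comap (QuotientGroup.mk' W)))).toTopRep) := by
  haveI : TotallyDisconnectedSpace (GaloisGroupUnramifiedOutside K S) :=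
    Literature.GroupTheory.ProfiniteSubquotients.totallyDisconnectedSpace_quotient
      (ramificationSubgroup K S) (ramificationSubgroup_isClosed K S)
  rw [natCard_restrictedCohomology_inflate_quotient]
  exact ContinuousRep.natCard_continuousCohomology_tensor_eq
    (ρ := (ContinuousRep.ofDiscrete σ).restrict (ContinuousMonoidHom.quotientMk W))
    W hWo σ (fun _ _ => rfl) C p hM _ (AddEquiv.refl _) (fun _ _ => rfl) n

include hWo hM in
/-- **`ψ_W (M ⊗ ℤ[Q/C]/p)` in `U`-currency**: for `M` finite killed by `p`,
`χ_{p,e}(inflate π_W (M ⊗ ℤ[Q/C]/p)) = v_p #H⁰(U, M) − v_p #H¹(U, M) + v_p #H²(U, M) + [G_S:U]·e·v_p #M`,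
`U = C.comap (G_S ↠ Q)` (Shapiro in each degree and `#(M ⊗ ℤ[Q/C]/p) = #M^{[G_S:U]}`).
[cite: SerreGaloisCohomology1997, I §2.5 Prop. 10] [cite: MilneADT2006, I §5 (proof of Thm. 5.1, p. 70)] -/
theorem eulerChar_inflate_tprod_permQuot [Finite M] [Fact p.Prime] (e : ℕ) :
    ((padicValNat p (Nat.card (restrictedCohomology
        (inflate ((ContinuousMonoidHom.quotientMk W).comp (toUnramifiedQuotCont K S))
          (Representation.ofIntModule _
            (σ.tprod (Representation.permQuot ((GaloisGroupUnramifiedOutside K S ⧸ W) ⧸ C) p)))) S 0)) : ℤ) -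
        padicValNat p (Nat.card (restrictedCohomology
          (inflate ((ContinuousMonoidHom.quotientMk W).comp (toUnramifiedQuotCont K S))
            (Representation.ofIntModule _
              (σ.tprod (Representation.permQuot ((GaloisGroupUnramifiedOutside K S ⧸ W) ⧸ C) p)))) S 1)) +
        padicValNat p (Nat.card (restrictedCohomology
          (inflate ((ContinuousMonoidHom.quotientMk W).comp (toUnramifiedQuotCont K S))
            (Representation.ofIntModule _
              (σ.tprod (Representation.permQuot ((GaloisGroupUnramifiedOutside K S ⧸ W) ⧸ C) p)))) S 2)) +
      e * padicValNat p (Nat.card (M ⊗[ℤ]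
        (MonoidAlgebra ℤ ((GaloisGroupUnramifiedOutside K S ⧸ W) ⧸ C) ⧸
          ((p : ℤ) • ⊤ : Submodule ℤ (MonoidAlgebra ℤ ((GaloisGroupUnramifiedOutside K S ⧸ W) ⧸ C))))))) =
    ((padicValNat p (Nat.card (continuousCohomology 0
        (((ContinuousRep.ofDiscrete σ).restrict (ContinuousMonoidHom.quotientMk W)).restrict
          (subgroupIncl (C.comap (QuotientGroup.mk' W)))).toTopRep)) : ℤ) -
        padicValNat p (Nat.card (continuousCohomology 1
          (((ContinuousRep.ofDiscrete σ).restrict (ContinuousMonoidHom.quotientMk W)).restrict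
            (subgroupIncl (C.comap (QuotientGroup.mk' W)))).toTopRep)) +
        padicValNat p (Nat.card (continuousCohomology 2
          (((ContinuousRep.ofDiscrete σ).restrict (ContinuousMonoidHom.quotientMk W)).restrict
            (subgroupIncl (C.comap (QuotientGroup.mk' W)))).toTopRep)) +
      ((C.comap (QuotientGroup.mk' W)).index * e : ℕ) * padicValNat p (Nat.card M)) := by
  rw [natCard_restrictedCohomology_inflate_tprod_permQuot S W hWo σ p hM C 0,
    natCard_restrictedCohomology_inflate_tprod_permQuot S W hWo σ p hM C 1,
    natCard_restrictedCohomology_inflate_tprod_permQuot S W hWo σ p hM C 2,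
    ContinuousRep.natCard_tensor_permQuot_eq W hWo C p hM, padicValNat.pow]
  push_cast
  ring

end Tensor

/-! ### §3. `ψ_W ≡ 0` from (BASE) at the cyclic subgroups of `Q` of order prime to `p` -/

section Base

variable [IsTotallyComplex K]

/-- **Milne's reduction "we can assume that `Ḡ` is cyclic of order prime to `p`", at a totally
complex `K`.**  Let `S ⊇ S_p` be finite, `W ⊴ G_S` open, `Q = G_S ⧸ W`, and grant
`finite_restrictedCohomology K` (Harari Cor. 17.17).  If for every CYCLIC `C ≤ Q` of order PRIME TO
`p`, `U = C.comap (G_S ↠ Q)`, and every finite `ℤ[Q]`-module `M` killed by `p`,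
`v_p #H⁰(U, M) − v_p #H¹(U, M) + v_p #H²(U, M) + [G_S : U]·e·v_p #M = 0` (BASE), then
`χ_{p,e}(inflate π_W σ) = v_p #H⁰(G_S, M) − v_p #H¹(G_S, M) + v_p #H²(G_S, M) + e·v_p #M = 0` for
EVERY finite `ℤ[Q]`-module `σ` on `M` killed by `p` (Artin induction + the `p`-part step,
`ArtinReduction.additive_eq_zero_of_cyclic_primeToP`, applied to the additive invariant
`ψ_W = χ_{p,e} ∘ inflate π_W` of `eulerChar_inflate_add`).
[cite: MilneADT2006, I §5 Thm. 5.1 (proof, p. 70) and Lemma 2.10 (p. 32)]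
[cite: Harari2020, Cor. 17.17 and Def. 15.36] -/
theorem eulerChar_inflate_eq_zero_of_base (hfinK : finite_restrictedCohomology K)
    (hSfin : S.Finite) (p : ℕ) [Fact p.Prime]
    (hSp : ∀ v : HeightOneSpectrum (𝓞 K), ((p : ℕ) : 𝓞 K) ∈ v.asIdeal → v ∈ S)
    (hWo : IsOpen (W : Set (GaloisGroupUnramifiedOutside K S)))
    [DiscreteTopology (GaloisGroupUnramifiedOutside K S ⧸ W)] (e : ℕ)
    (hbase : ∀ (C : Subgroup (GaloisGroupUnramifiedOutside K S ⧸ W))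
      [Fintype ((GaloisGroupUnramifiedOutside K S ⧸ W) ⧸ C)], IsCyclic C → (Nat.card C).Coprime p →
      ∀ (M : Type) [AddCommGroup M] [TopologicalSpace M] [DiscreteTopology M] [Finite M]
        (σ : Representation ℤ (GaloisGroupUnramifiedOutside K S ⧸ W) M), (∀ m : M, (p : ℤ) • m = 0) →
        ((padicValNat p (Nat.card (continuousCohomology 0
            (((ContinuousRep.ofDiscrete σ).restrict (ContinuousMonoidHom.quotientMk W)).restrict
              (subgroupIncl (C.comap (QuotientGroup.mk' W)))).toTopRep)) : ℤ) -
            padicValNat p (Nat.card (continuousCohomology 1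
              (((ContinuousRep.ofDiscrete σ).restrict (ContinuousMonoidHom.quotientMk W)).restrict
                (subgroupIncl (C.comap (QuotientGroup.mk' W)))).toTopRep)) +
            padicValNat p (Nat.card (continuousCohomology 2
              (((ContinuousRep.ofDiscrete σ).restrict (ContinuousMonoidHom.quotientMk W)).restrict
                (subgroupIncl (C.comap (QuotientGroup.mk' W)))).toTopRep)) +
          ((C.comap (QuotientGroup.mk' W)).index * e : ℕ) * padicValNat p (Nat.card M)) = 0)
    (M : Type) [AddCommGroup M] [TopologicalSpace M] [DiscreteTopology M] [Finite M]
    (σ : Representation ℤ (GaloisGroupUnramifiedOutside K S ⧸ W) M) (hM : ∀ m : M, (p : ℤ) • m = 0) :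
    ((padicValNat p (Nat.card (restrictedCohomology
        (inflate ((ContinuousMonoidHom.quotientMk W).comp (toUnramifiedQuotCont K S))
          (Representation.ofIntModule _ σ)) S 0)) : ℤ) -
        padicValNat p (Nat.card (restrictedCohomology
          (inflate ((ContinuousMonoidHom.quotientMk W).comp (toUnramifiedQuotCont K S))
            (Representation.ofIntModule _ σ)) S 1)) +
        padicValNat p (Nat.card (restrictedCohomology
          (inflate ((ContinuousMonoidHom.quotientMk W).comp (toUnramifiedQuotCont K S))
            (Representation.ofIntModule _ σ)) S 2)) +
      e * padicValNat p (Nat.card M)) = 0 := by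
  -- normalise the (discrete) topology of `M` to `⊥`
  have htop : ‹TopologicalSpace M› = ⊥ := DiscreteTopology.eq_bot
  subst htop
  haveI : Finite (GaloisGroupUnramifiedOutside K S ⧸ W) := Subgroup.quotient_finite_of_isOpen W hWo
  haveI : Fintype (GaloisGroupUnramifiedOutside K S ⧸ W) := Fintype.ofFinite _
  set π := (ContinuousMonoidHom.quotientMk W).comp (toUnramifiedQuotCont K S) with hπdef
  have hπ : ∀ τ ∈ ramificationSubgroup K S, π τ = 1 := toUnramifiedQuot_comp_eq_one_of_mem S W
  -- the additive invariant `ψ_W = χ_{p,e} ∘ inflate π_W` (carriers given the discrete topology)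
  let ψ : ∀ ⦃Y : Type⦄ [AddCommGroup Y] [Module ℤ Y],
      Representation ℤ (GaloisGroupUnramifiedOutside K S ⧸ W) Y → ℤ :=
    fun Y _ inst ρY =>
      letI : TopologicalSpace Y := ⊥
      haveI : DiscreteTopology Y := ⟨rfl⟩
      (padicValNat p (Nat.card (restrictedCohomology
          (inflate π (Representation.ofIntModule inst ρY)) S 0)) : ℤ) -
        padicValNat p (Nat.card (restrictedCohomology
          (inflate π (Representation.ofIntModule inst ρY)) S 1)) +
        padicValNat p (Nat.card (restrictedCohomology
          (inflate π (Representation.ofIntModule inst ρY)) S 2)) +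
        e * padicValNat p (Nat.card Y)
  have hψ : ∀ ⦃X Y Z : Type⦄ [AddCommGroup X] [Module ℤ X] [AddCommGroup Y] [Module ℤ Y]
      [AddCommGroup Z] [Module ℤ Z]
      (ρX : Representation ℤ (GaloisGroupUnramifiedOutside K S ⧸ W) X)
      (ρY : Representation ℤ (GaloisGroupUnramifiedOutside K S ⧸ W) Y)
      (ρZ : Representation ℤ (GaloisGroupUnramifiedOutside K S ⧸ W) Z) (f : X →ₗ[ℤ] Y) (g : Y →ₗ[ℤ] Z),
      (∀ s x, f (ρX s x) = ρY s (f x)) → (∀ s y, g (ρY s y) = ρZ s (g y)) →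
      Injective f → Surjective g → LinearMap.range f = LinearMap.ker g → Finite Y →
      (∀ y : Y, (p : ℤ) • y = 0) → ψ ρY = ψ ρX + ψ ρZ := by
    intro X Y Z _ instX _ instY _ instZ ρX ρY ρZ f g hf hg hinj hsurj hex hfin hpY
    letI : TopologicalSpace X := ⊥
    haveI : DiscreteTopology X := ⟨rfl⟩
    letI : TopologicalSpace Y := ⊥
    haveI : DiscreteTopology Y := ⟨rfl⟩
    letI : TopologicalSpace Z := ⊥
    haveI : DiscreteTopology Z := ⟨rfl⟩
    exact eulerChar_inflate_add π hfinK hSfin p hSp hπ e ρX ρY ρZ f g hf hg hinj hsurj hex hfin hpY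
  -- (BASE) in `Q`-currency
  have hbase' : ∀ (C : Subgroup (GaloisGroupUnramifiedOutside K S ⧸ W))
      [Fintype ((GaloisGroupUnramifiedOutside K S ⧸ W) ⧸ C)], IsCyclic C → (Nat.card C).Coprime p →
      ∀ ⦃M : Type⦄ [AddCommGroup M] [Finite M]
        (σ : Representation ℤ (GaloisGroupUnramifiedOutside K S ⧸ W) M),
        (∀ m : M, (p : ℤ) • m = 0) →
        ψ (σ.tprod (Representation.permQuot ((GaloisGroupUnramifiedOutside K S ⧸ W) ⧸ C) p)) = 0 := by
    intro C _ hC hcop M _ _ σ hM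
    letI : TopologicalSpace M := ⊥
    haveI : DiscreteTopology M := ⟨rfl⟩
    letI : TopologicalSpace (M ⊗[ℤ]
        (MonoidAlgebra ℤ ((GaloisGroupUnramifiedOutside K S ⧸ W) ⧸ C) ⧸
          ((p : ℤ) • ⊤ : Submodule ℤ (MonoidAlgebra ℤ ((GaloisGroupUnramifiedOutside K S ⧸ W) ⧸ C))))) := ⊥
    haveI : DiscreteTopology (M ⊗[ℤ]
        (MonoidAlgebra ℤ ((GaloisGroupUnramifiedOutside K S ⧸ W) ⧸ C) ⧸
          ((p : ℤ) • ⊤ : Submodule ℤ (MonoidAlgebra ℤ ((GaloisGroupUnramifiedOutside K S ⧸ W) ⧸ C))))) :=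
      ⟨rfl⟩
    have h := eulerChar_inflate_tprod_permQuot S W hWo σ p hM C e
    rw [hbase C hC hcop M σ hM] at h
    exact h
  exact ArtinReduction.additive_eq_zero_of_cyclic_primeToP ψ hψ hbase' σ hM

end Base

end Literature.NumberTheory.GaloisCohomology

end
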